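import Literature.AnabelianGeometry.EtaleTheta.SettingModelTateDeckDisplay
import Literature.AnabelianGeometry.EtaleTheta.SettingModelChiTwistedSections
import Literature.AnabelianGeometry.EtaleTheta.ThetaKummerInversionInnerLiftsNoGoTate
import Literature.AnabelianGeometry.EtaleTheta.Discharge.Sec1Prop15iiiOfThetaKummerInput
import Literature.AnabelianGeometry.EtaleTheta.Discharge.Sec1InversionEtaDdSign
import Literature.AnabelianGeometry.EtaleTheta.ThetaKummerInversionTransport
import Literature.AnabelianGeometry.EtaleTheta.SettingModelTateDoubleUnderline
import HarnessLib

/-!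
# The STAGE-2 («Tate shear») model of [EtTh] §1: the CLASS-LEVEL deck-sign clause (P14ii-cl) for `η̈♯ = etaDdχq` is
# REFUTED — the deck transformations of `Ÿ → Y` FIX `η̈♯` (proof-only; non-vacuity census)

S. Mochizuki, *The étale theta function and its Frobenioid-theoretic manifestations*, Publ. RIMS **45** (2009) [EtTh],
Prop. 1.4 (ii), PRIMS PDF p. 22 l. 5–9 («`Θ̈(−Ü) = −Θ̈(Ü)`»); Prop. 1.5 (iii) p. 23 [cite: MochizukiEtTh2009, Prop 1.4 (ii) p.22].
abc-iut cell, seat abc-iut-w5-d095 (gen 8); by-product of the RQ7 second read WITH KERNEL PROBE of p488825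
(`Literature/IUT/HodgeArakelov/ThetaEvaluationSettingModelOfInvClauses.lean`, abc-iut-w4-d010). PROOF-ONLY: no definition,
no `Prop` fact, no instance; everything consumed BY NAME (abc-iut-L2-t6 `conj_beta_zClassYddχq`, `etaDdχq_def`,
`inl_bPowGfp_mem_GtpY_modelχq`; `mem_GtpYdd_modelχq_iff_left`, `bPowGfp_mem_dY_iff`; `ThetaSetting.inflTheta_conj_toTheta`;
abc-iut-L2-t1 `EtaleThetaData.conj_etaDd_eq_of_deck_of_thetaKummer`).

THE QUESTION (SUBDAG-EtTh-Prop14 row L09 (P14ii-cl); GAP row D-G-w4d010-2f; binder `hdeck` of p488825 / `hdeckFn` of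
p465052). The class-level reading of Prop. 1.4 (ii) for the deck transformation `Ü ↦ −Ü` of `Ÿ → Y` —
«for every `ε ∈ Π^tp_Y ∖ Π^tp_Ÿ`, `conj_ε η̈^Θ = κ(−1)·η̈^Θ` in `H¹(Π^tp_Ÿ, Δ_Θ)`» — is a TRUE statement about the genuine
`Θ̈`; is it instantiable at the tree's stage-2 model of record `ThetaSetting.modelχq p i j` with `η̈♯ := etaDdχq`?
ANSWER (kernel): NO, for every `p`, every `i`, every even `j`, and EVERY étale-theta datum `E` with `E.etaDd = etaDdχq`:
* `conj_inl_bPowGfp_etaDdχq` — every deck power `β_t = (b^t, 1)` FIXES `η̈♯` (it fixes abc-iut-L2-t6's `z`-class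
  `x′ = zClassYddχq`, and `η̈♯ = infl x′`);
* `inl_bPowGfp_eta_one_mem_GtpY_not_mem_GtpYdd_modelχq` — `β_{η(1)} ∈ Π^tp_Y ∖ Π^tp_Ÿ`;
* `inflTheta_kumYdd_negOne_ne_one` — `κ(−1) ≠ 1` in `H¹(Π^tp_Ÿ, Δ_Θ)` for every Kummer datum over the model;
* `conj_etaDdχq_eq_self_of_mem_GtpY` — in fact EVERY `y ∈ Π^tp_Y` fixes `η̈♯` (`Π^tp_Y ≤ ⟨β, Π^tp_Ÿ⟩`,
  abc-iut-L2-t6 `GtpY_le_closure_beta_GtpYdd`; inner action of `Π^tp_Ÿ` trivial);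
* **`not_hdeck_modelχq`** — hence the clause is FALSE there; **`not_hdeck_Huu_modelχq`** — also in the
  `X̲̲`-restricted currency of the L6 consumers (deck elements inside `Π^tp_X̲̲ = C.Huu`, for EVERY `X̲̲`-choice `C`;
  `Sec2Hyps` holds at the model); **`not_exists_thetaKummerDeck_modelχq`** — and so is its
  function-level feed (no theta-Kummer input `T` with `E.etaDd = T.kummerTheta`, `ConstCompat`, and the deck identity
  `ε • Θ̈ = const(−1)·Θ̈`) — the DECK half of the Prop. 1.4 (ii) package, complementing abc-iut-w5-d125's no-go for the
  `ι`-half (`ThetaKummerInversionInnerLiftsNoGo(Tate)`).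
CENSUS TOKEN: «(P14ii-cl) for `η̈♯ = etaDdχq`: REFUTED at `modelχq` (all `p`, `i`, even `j`)». CONSEQUENCE for the
h14orbit route (p488825): at the model of record the binders {`IsInversionAut`, `InvClauses`, (h_sq), `Prop15ii`} are
witnessed (abc-iut-L2 files) and the conclusion holds with `τ₀ := 1` (abc-iut-w5-d072 `autMap_comap_etaDd_eq_self_modelχq`),
while `hdeck` — used only in the branch `transport_ι η̈ ≠ η̈` — is refuted; no joint instance of the full binder set exists
in the tree. DIAGNOSIS (model design, numbers not a side): the stage-2 model carries the sign `Ü ↦ −Ü` on `log(Ü)`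
(abc-iut-L2-t6 `conj_beta_logUdd`) but its theta `z`-class ignores the `y`-coordinate.

HONEST FRAMING: SEMI-SYNTHETIC model — consistency / non-vacuity evidence for the typed interface ONLY; [EtTh] is refereed
and nothing of it is disputed or asserted here; no side is taken on [IUTchIII] Cor. 3.12; typed ≠ proved; refuted-at-a-model
≠ refuted.
-/

noncomputable section

namespace Literature.AnabelianGeometry.EtaleTheta.SettingModel

open Literature.AnabelianGeometry.SemiGraphs

variable (p : ℕ) [Fact p.Prime] (i j : ℤ)

/-- **The deck powers `β_t = (b^t, 1)` FIX `η̈♯ = etaDdχq`** at `modelχq p i j` (any `i`, even `j`): `η̈♯` is the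
inflation of abc-iut-L2-t6's `z`-class `x′`, which `β_t` fixes (`conj_beta_zClassYddχq`), and inflation intertwines the
conjugation actions (`inflTheta_conj_toTheta`). [cite: MochizukiEtTh2009, Prop 1.5 (iii) p.23] -/
theorem conj_inl_bPowGfp_etaDdχq (hj : Even j) (hC : (ThetaSetting.modelχq p i j hj).Compat) (t : ZH) :
    haveI := hC.GtpYdd_normal
    ContH1.conj (ThetaSetting.modelχq p i j hj).toTheta (ThetaSetting.modelχq p i j hj).DeltaTheta
        (SemidirectProduct.inl (bPowGfp t) : PiTpχq p i j) (etaDdχq p i j hj) = etaDdχq p i j hj := by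
  haveI := hC.GtpYdd_normal
  haveI := hC.GtpYddTheta_normal
  rw [etaDdχq_def, ← ThetaSetting.inflTheta_conj_toTheta hC, conj_beta_zClassYddχq p i j hj hC t]

/-- **The basic deck element `β = (b^{η(1)}, 1)` lies in `Π^tp_Y` and NOT in `Π^tp_Ÿ`** at `modelχq` (odd level-`2`
`y`-coordinate; stage-2 twin of `inl_bPowGfp_eta_one_mem_GtpY_not_mem_GtpYdd`). [cite: MochizukiEtTh2009, §1 p.17] -/
theorem inl_bPowGfp_eta_one_mem_GtpY_not_mem_GtpYdd_modelχq (hj : Even j) :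
    (SemidirectProduct.inl (bPowGfp (ZHatLevel.eta 1)) : PiTpχq p i j) ∈ (ThetaSetting.modelχq p i j hj).GtpY ∧
      (SemidirectProduct.inl (bPowGfp (ZHatLevel.eta 1)) : PiTpχq p i j) ∉ (ThetaSetting.modelχq p i j hj).GtpYdd := by
  refine ⟨inl_bPowGfp_mem_GtpY_modelχq p i j hj _, fun h => ?_⟩
  rw [mem_GtpYdd_modelχq_iff_left, SemidirectProduct.left_inl, bPowGfp_mem_dY_iff, ZHatLevel.level_eta] at h
  exact absurd h (by decide)

/-- **`κ(−1) ≠ 1` in `H¹(Π^tp_Ÿ, Δ_Θ)`** for EVERY Kummer datum `E` over `modelχq`: `κ = kumYdd ∘ toKddHat` and the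
inflation are injective (`KummerData.kumYdd_injective`, `toKddHat_injective`, `inflTheta_injective`), and `−1 ≠ 1` in
`ℚ̄_p`. [cite: MochizukiEtTh2009, Prop 1.3 p.21] -/
theorem inflTheta_kumYdd_negOne_ne_one (hj : Even j) (E : (ThetaSetting.modelχq p i j hj).KummerData) :
    (ThetaSetting.modelχq p i j hj).inflTheta (ThetaSetting.modelχq p i j hj).GtpYdd (E.kumYdd (E.toKddHat (-1))) ≠ 1 := by
  intro h
  have h1 : E.kumYdd (E.toKddHat (-1)) = E.kumYdd (E.toKddHat 1) := by
    rw [map_one, map_one]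
    exact (ThetaSetting.modelχq p i j hj).inflTheta_injective _ (by rw [h, map_one])
  have h2 : (-1 : (↥(ThetaSetting.modelχq p i j hj).Kdd)ˣ) = 1 := E.toKddHat_injective (E.kumYdd_injective h1)
  have h3 : (((-1 : (↥(ThetaSetting.modelχq p i j hj).Kdd)ˣ) : (ThetaSetting.modelχq p i j hj).Kdd) : PadicAlgCl p) =
      (((1 : (↥(ThetaSetting.modelχq p i j hj).Kdd)ˣ) : (ThetaSetting.modelχq p i j hj).Kdd) : PadicAlgCl p) := by
    rw [h2]
  rw [Units.val_neg, Units.val_one] at h3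
  push_cast at h3
  norm_num at h3

/-- **(P14ii-cl) REFUTED at the stage-2 model of record.** For EVERY étale-theta datum `E` over `modelχq p i j`
(`j` even, `Compat`) carrying `η̈♯ = etaDdχq`, the class-level deck-sign clause «every `ε ∈ Π^tp_Y ∖ Π^tp_Ÿ` satisfies
`conj_ε η̈ = κ(−1)·η̈`» (binder `hdeck` of p488825, root currency) is FALSE: `β_{η(1)}` fixes `η̈♯` while
`κ(−1)·η̈♯ ≠ η̈♯`. [cite: MochizukiEtTh2009, Prop 1.4 (ii) p.22] -/
theorem not_hdeck_modelχq (hj : Even j) (hC : (ThetaSetting.modelχq p i j hj).Compat)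
    (E : (ThetaSetting.modelχq p i j hj).EtaleThetaData) (hE : E.etaDd = etaDdχq p i j hj) :
    haveI := hC.GtpYdd_normal
    ¬ ∀ ε : PiTpχq p i j, ε ∈ (ThetaSetting.modelχq p i j hj).GtpY → ε ∉ (ThetaSetting.modelχq p i j hj).GtpYdd →
        ContH1.conj (ThetaSetting.modelχq p i j hj).toTheta (ThetaSetting.modelχq p i j hj).DeltaTheta ε E.etaDd =
          (ThetaSetting.modelχq p i j hj).inflTheta (ThetaSetting.modelχq p i j hj).GtpYdd
            (E.kumYdd (E.toKddHat (-1))) * E.etaDd := by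
  haveI := hC.GtpYdd_normal
  intro h
  obtain ⟨hY, hYdd⟩ := inl_bPowGfp_eta_one_mem_GtpY_not_mem_GtpYdd_modelχq p i j hj
  have key := h _ hY hYdd
  rw [hE, conj_inl_bPowGfp_etaDdχq p i j hj hC] at key
  exact inflTheta_kumYdd_negOne_ne_one p i j hj E.toKummerData (mul_right_cancel (key.symm.trans (one_mul _).symm))

/-- **… hence the FUNCTION-LEVEL feed has no instance there either**: for such `E` there is NO theta-Kummer input `T`
over `modelχq` with `E.etaDd = T.kummerTheta`, `ConstCompat`, and the deck identity `ε • Θ̈ = const(−1)·Θ̈` for all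
`ε ∈ Π^tp_Y ∖ Π^tp_Ÿ` (abc-iut-L2-t1's `EtaleThetaData.conj_etaDd_eq_of_deck_of_thetaKummer` would produce the refuted
clause) — the DECK half of the Prop. 1.4 (ii) package at the model of record, complementing abc-iut-w5-d125's no-go for
the `ι`-half. [cite: MochizukiEtTh2009, Prop 1.4 (ii) p.22] -/
theorem not_exists_thetaKummerDeck_modelχq (hj : Even j) (hC : (ThetaSetting.modelχq p i j hj).Compat)
    (E : (ThetaSetting.modelχq p i j hj).EtaleThetaData) (hE : E.etaDd = etaDdχq p i j hj) :
    ¬ ∃ T : (ThetaSetting.modelχq p i j hj).ThetaKummerInput, letI := T.instAction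
      E.etaDd = T.kummerTheta ∧ T.ConstCompat E.toKummerData ∧
        ∀ ε : PiTpχq p i j, ε ∈ (ThetaSetting.modelχq p i j hj).GtpY → ε ∉ (ThetaSetting.modelχq p i j hj).GtpYdd →
          ε • T.theta = T.const (-1) * T.theta := by
  haveI := hC.GtpYdd_normal
  rintro ⟨T, hη, hcc, hdeckFn⟩
  exact not_hdeck_modelχq p i j hj hC E hE
    (fun ε hε₁ hε₂ => E.conj_etaDd_eq_of_deck_of_thetaKummer T hη hcc hdeckFn hε₁ hε₂)

/-- **EVERY element of `Π^tp_Y` FIXES `η̈♯ = etaDdχq`** at `modelχq p i j`: `Π^tp_Y ≤ ⟨β, Π^tp_Ÿ⟩`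
(abc-iut-L2-t6 `GtpY_le_closure_beta_GtpYdd`), `β` fixes `η̈♯` (`conj_inl_bPowGfp_etaDdχq`) and `Π^tp_Ÿ` acts trivially on
`H¹(Π^tp_Ÿ, Δ_Θ)` (`ContH1.conj_eq_self_of_mem`). So at the model of record the whole `Π^tp_Y/Π^tp_Ÿ`-move of `η̈♯` is
trivial («`+ log(O^×_K̈)`» with unit `1`). [cite: MochizukiEtTh2009, Prop 1.5 (iii) p.23] -/
theorem conj_etaDdχq_eq_self_of_mem_GtpY (hj : Even j) (hC : (ThetaSetting.modelχq p i j hj).Compat)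
    {y : PiTpχq p i j} (hy : y ∈ (ThetaSetting.modelχq p i j hj).GtpY) :
    haveI := hC.GtpYdd_normal
    ContH1.conj (ThetaSetting.modelχq p i j hj).toTheta (ThetaSetting.modelχq p i j hj).DeltaTheta y (etaDdχq p i j hj) =
      etaDdχq p i j hj := by
  haveI := hC.GtpYdd_normal
  have key : ∀ x ∈ Subgroup.closure
      ({(SemidirectProduct.inl (bPowGfp (iotaZ (Multiplicative.ofAdd 1))) : PiTpχq p i j)} ∪
        ((ThetaSetting.modelχq p i j hj).GtpYdd : Set (PiTpχq p i j))),
      ContH1.conj (ThetaSetting.modelχq p i j hj).toTheta (ThetaSetting.modelχq p i j hj).DeltaTheta x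
        (etaDdχq p i j hj) = etaDdχq p i j hj := by
    intro x hx
    induction hx using Subgroup.closure_induction with
    | mem x hx =>
      rcases hx with hx | hx
      · rw [Set.mem_singleton_iff] at hx
        subst hx
        exact conj_inl_bPowGfp_etaDdχq p i j hj hC _
      · exact ContH1.conj_eq_self_of_mem _ hx _
    | one => exact ContH1.conj_one_apply _
    | mul x z _ _ hx hz => rw [ContH1.conj_mul_apply, hz, hx]
    | inv x _ hx =>
      conv_lhs => rw [← hx]
      exact ContH1.conj_inv_conj_apply _ _
  exact key y (GtpY_le_closure_beta_GtpYdd p i j hj hy)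

/-- **(P14ii-cl) REFUTED at the model of record in the `X̲̲`-RESTRICTED currency of the L6 consumers** (binder `hdeck`
of p488825 §2/§3 quantifies over deck elements INSIDE `Π^tp_X̲̲ = C.Huu`): for EVERY étale-theta datum `E` over
`modelχq p i j` with `E.etaDd = etaDdχq` and EVERY `X̲̲`-choice `C`, the clause «every `ε ∈ Π^tp_X̲̲ ∩ (Π^tp_Y ∖ Π^tp_Ÿ)`
has `conj_ε η̈ = κ(−1)·η̈`» is FALSE — a deck element inside `Π^tp_X̲̲` exists (`Sec2Hyps` holds at the model:
`modelχq_sec2Hyps`; abc-iut-w5-d125 `exists_mem_Huu_mem_GtpY_not_mem_GtpYdd`) and fixes `η̈♯`.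
[cite: MochizukiEtTh2009, Prop 1.4 (ii) p.22] -/
theorem not_hdeck_Huu_modelχq (hj : Even j) (hC : (ThetaSetting.modelχq p i j hj).Compat)
    (E : (ThetaSetting.modelχq p i j hj).EtaleThetaData) (hE : E.etaDd = etaDdχq p i j hj)
    {l : ℕ} (C : E.DoubleUnderline l) :
    haveI := hC.GtpYdd_normal
    ¬ ∀ ε ∈ C.Huu, ε ∈ (ThetaSetting.modelχq p i j hj).GtpY → ε ∉ (ThetaSetting.modelχq p i j hj).GtpYdd →
        ContH1.conj (ThetaSetting.modelχq p i j hj).toTheta (ThetaSetting.modelχq p i j hj).DeltaTheta ε E.etaDd =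
          (ThetaSetting.modelχq p i j hj).inflTheta (ThetaSetting.modelχq p i j hj).GtpYdd
            (E.kumYdd (E.toKddHat (-1))) * E.etaDd := by
  haveI := hC.GtpYdd_normal
  intro h
  obtain ⟨ε, hεH, hε₁, hε₂⟩ := C.exists_mem_Huu_mem_GtpY_not_mem_GtpYdd (ThetaSetting.modelχq_sec2Hyps p i j hj)
  have key := h ε hεH hε₁ hε₂
  rw [hE, conj_etaDdχq_eq_self_of_mem_GtpY p i j hj hC hε₁] at key
  exact inflTheta_kumYdd_negOne_ne_one p i j hj E.toKummerData (mul_right_cancel (key.symm.trans (one_mul _).symm))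

/-- **Census form.** At `modelχq p i j` the deck element `β_{η(1)} ∈ Π^tp_Y ∖ Π^tp_Ÿ` acts TRIVIALLY on `η̈♯` — the
explicit witness against (P14ii-cl), packaged as one existential for the K-census desks. [cite: MochizukiEtTh2009, Prop 1.4 (ii) p.22] -/
theorem exists_deck_fixes_etaDdχq (hj : Even j) (hC : (ThetaSetting.modelχq p i j hj).Compat) :
    haveI := hC.GtpYdd_normal
    ∃ ε : PiTpχq p i j, ε ∈ (ThetaSetting.modelχq p i j hj).GtpY ∧ ε ∉ (ThetaSetting.modelχq p i j hj).GtpYdd ∧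
      ContH1.conj (ThetaSetting.modelχq p i j hj).toTheta (ThetaSetting.modelχq p i j hj).DeltaTheta ε (etaDdχq p i j hj) =
        etaDdχq p i j hj := by
  haveI := hC.GtpYdd_normal
  obtain ⟨hY, hYdd⟩ := inl_bPowGfp_eta_one_mem_GtpY_not_mem_GtpYdd_modelχq p i j hj
  exact ⟨_, hY, hYdd, conj_inl_bPowGfp_etaDdχq p i j hj hC _⟩

end Literature.AnabelianGeometry.EtaleTheta.SettingModel

end
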